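import Mathlib
import HarnessLib
import Summits.HubbardSuperconductivity.HubbardSuperconductivity.Theorems.WeakCouplingBCSWcbcsKohnLuttingerB1gPolarTransport
import Literature.Computability.MetaComplexity.TaylorCosineMinorants

/-!
# Route `WeakCouplingBCS` — support item `WcbcsKohnLuttingerB1g` (stmt-HubbardSuperconductivity-0158):
# a kernel-checkable zero-order quadrature for integrals against the polar density of states (R2dCERT, rung R2/T3)

The in-kernel discharge of the certificate hypothesis `KLCert.EnclosuresB1g` (cell gate-hubbard-kl,
HOME/eng/ENCLOSURES-SCOPE.md) needs certified enclosures of `θ`-integrals against the polar density of states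
`w_μ(θ) = u_μ(θ)/∂_tF(θ, u_μ(θ))` (`klpt_fermiPolarDOS_eq`), where `u_μ(θ)` is the implicit Fermi radius
(`F(θ, u) = -2(cos(u cos θ) + cos(u sin θ)) = μ`).  This file is the record-agnostic SOUNDNESS layer of a reflected
checker over `ℚ` (the first rung R2 = `FermiCurveMassD010` and the B1g norm R3 instantiate it):

* `qCosT`/`qSinT` — the Taylor polynomials of `cos`/`sin` over `ℚ` (structural recursion, kernel-evaluable) and their
  enclosures `cosLo ≤ cos ≤ cosHi` (orders 7/8, all reals), `sinLo ≤ sin ≤ sinHi` (on `[0, ∞)`) from the tree's global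
  alternating bounds `Literature.Computability.MetaComplexity.cos_le_cosTaylorSum` & co.;
* `DOSCell` — a `θ`-cell `[a, b] ⊂ [0, 3/2]` with a claimed bracket `ulo ≤ u_μ(θ) ≤ uhi`; `DOSCell.ok μq` — the RATIONAL
  conditions under which the bracket is certified (monotonicity of `F(θ, ·)`, `strictMonoOn_rayDispersion_band`, with `cos`,
  `sin` of the cell replaced by their endpoint enclosures) and `DOSCell.wLo/wHi` — the induced bracket of `w_μ` on the cell;
* **`DOSCell.wLo_le` / `DOSCell.le_wHi`** — soundness: `ok μq c = true → ∀ θ ∈ [a,b], wLo ≤ w_μ(θ) ≤ wHi` (`μ = μq`);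
* `chainLower/chainUpper` + **`chainLower_le_integral` / `integral_le_chainUpper`** — for a list of cells chained from `s`
  to `e`, `Σ wLo·(b-a) ≤ ∫_s^e w_μ ≤ Σ wHi·(b-a)`.

Everything is proved; the only definitions are the checker's rational functions (no analytic content is hidden in them:
each is a finite `ℚ` expression). [folklore]
-/

noncomputable section

-- the tree's namespace `Summit.<Summit>.<Problem>.Theorems` repeats the summit name by design (D-0017)
set_option linter.dupNamespace false

namespace Summit.HubbardSuperconductivity.HubbardSuperconductivity.Theorems.KlCertQuad

open Real Set MeasureTheory Finset Literature.MathematicalPhysics.QuantumLattice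

/-! ### Rational Taylor enclosures of `cos` and `sin` -/

/-- The Taylor polynomial `T_M(x) = Σ_{i ≤ M} (-1)^i x^{2i}/(2i)!` of `cos`, over `ℚ`, by structural recursion. [folklore] -/
def qCosT : ℕ → ℚ → ℚ
  | 0, _ => 1
  | M + 1, x => qCosT M x + (-1) ^ (M + 1) * x ^ (2 * (M + 1)) / ((2 * (M + 1)).factorial : ℚ)

/-- The Taylor polynomial `S_M(x) = Σ_{i ≤ M} (-1)^i x^{2i+1}/(2i+1)!` of `sin`, over `ℚ`. [folklore] -/
def qSinT : ℕ → ℚ → ℚ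
  | 0, x => x
  | M + 1, x => qSinT M x + (-1) ^ (M + 1) * x ^ (2 * (M + 1) + 1) / ((2 * (M + 1) + 1).factorial : ℚ)

/-- `qCosT` is the tree's raw Taylor sum (cast to `ℝ`). [folklore] -/
theorem cast_qCosT (M : ℕ) (x : ℚ) :
    ((qCosT M x : ℚ) : ℝ) = ∑ i ∈ range (M + 1), (-1 : ℝ) ^ i * (x : ℝ) ^ (2 * i) / ((2 * i).factorial : ℝ) := by
  induction M with
  | zero => simp [qCosT]
  | succ M ih => rw [qCosT, Finset.sum_range_succ, ← ih]; push_cast; ring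

/-- `qSinT` is the tree's raw Taylor sum (cast to `ℝ`). [folklore] -/
theorem cast_qSinT (M : ℕ) (x : ℚ) :
    ((qSinT M x : ℚ) : ℝ) = ∑ i ∈ range (M + 1), (-1 : ℝ) ^ i * (x : ℝ) ^ (2 * i + 1) / ((2 * i + 1).factorial : ℝ) := by
  induction M with
  | zero => simp [qSinT]
  | succ M ih => rw [qSinT, Finset.sum_range_succ, ← ih]; push_cast; ring

/-- Lower Taylor enclosure of `cos` (order 7, all reals). [folklore] -/
def cosLo (x : ℚ) : ℚ := qCosT 7 x
/-- Upper Taylor enclosure of `cos` (order 8, all reals). [folklore] -/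
def cosHi (x : ℚ) : ℚ := qCosT 8 x
/-- Lower Taylor enclosure of `sin` on `[0, ∞)` (order 7). [folklore] -/
def sinLo (x : ℚ) : ℚ := qSinT 7 x
/-- Upper Taylor enclosure of `sin` on `[0, ∞)` (order 8). [folklore] -/
def sinHi (x : ℚ) : ℚ := qSinT 8 x

/-- `cosLo x ≤ cos x`. [folklore] -/
theorem cosLo_le (x : ℚ) : ((cosLo x : ℚ) : ℝ) ≤ Real.cos x := by
  rw [cosLo, cast_qCosT]
  exact Literature.Computability.MetaComplexity.cosTaylorSum_le_cos (by decide) _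

/-- `cos x ≤ cosHi x`. [folklore] -/
theorem le_cosHi (x : ℚ) : Real.cos x ≤ ((cosHi x : ℚ) : ℝ) := by
  rw [cosHi, cast_qCosT]
  exact Literature.Computability.MetaComplexity.cos_le_cosTaylorSum (by decide) _

/-- `sinLo x ≤ sin x` for `x ≥ 0`. [folklore] -/
theorem sinLo_le {x : ℚ} (hx : 0 ≤ x) : ((sinLo x : ℚ) : ℝ) ≤ Real.sin x := by
  rw [sinLo, cast_qSinT]
  exact Literature.Computability.MetaComplexity.sinTaylorSum_le_sin (by decide) (by exact_mod_cast hx)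

/-- `sin x ≤ sinHi x` for `x ≥ 0`. [folklore] -/
theorem le_sinHi {x : ℚ} (hx : 0 ≤ x) : Real.sin x ≤ ((sinHi x : ℚ) : ℝ) := by
  rw [sinHi, cast_qSinT]
  exact Literature.Computability.MetaComplexity.sin_le_sinTaylorSum (by decide) (by exact_mod_cast hx)

/-! ### Rational constants around `π` -/

/-- A rational lower bound of `π`. [folklore] -/
def piLo : ℚ := 3141592 / 1000000
/-- A rational lower bound of `π/2`. [folklore] -/
def pi2Lo : ℚ := 1570796 / 1000000
/-- A rational upper bound of `π/2`. [folklore] -/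
def pi2Hi : ℚ := 15707965 / 10000000

/-- `piLo < π`. [folklore] -/
theorem piLo_lt_pi : ((piLo : ℚ) : ℝ) < π := by
  have := Real.pi_gt_d6; rw [piLo]; push_cast; linarith
/-- `pi2Lo < π/2`. [folklore] -/
theorem pi2Lo_lt : ((pi2Lo : ℚ) : ℝ) < π / 2 := by
  have := Real.pi_gt_d6; rw [pi2Lo]; push_cast; linarith
/-- `π/2 < pi2Hi`. [folklore] -/
theorem lt_pi2Hi : π / 2 < ((pi2Hi : ℚ) : ℝ) := by
  have := Real.pi_lt_d6; rw [pi2Hi]; push_cast; linarith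

/-! ### Enclosure of `sin` on a sub-interval of `[0, π]` -/

/-- Lower bracket of `sin` on `[p, q] ⊂ [0, π]`: the minimum of the endpoint lower enclosures. [folklore] -/
def sinBrLo (p q : ℚ) : ℚ := min (sinLo p) (sinLo q)

/-- Upper bracket of `sin` on `[p, q] ⊂ [0, π]`: endpoint value on a monotone piece, else `1`. [folklore] -/
def sinBrHi (p q : ℚ) : ℚ := if q ≤ pi2Lo then sinHi q else if pi2Hi ≤ p then sinHi p else 1

/-- On `[p, q] ⊂ [0, π]` the sine is at least its smaller endpoint value. [folklore] -/
theorem min_sin_le_sin {p q x : ℝ} (hp : 0 ≤ p) (hq : q ≤ π) (hpx : p ≤ x) (hxq : x ≤ q) :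
    min (Real.sin p) (Real.sin q) ≤ Real.sin x := by
  rcases le_total x (π / 2) with hx | hx
  · -- increasing piece `[p, x] ⊂ [-π/2, π/2]`
    exact (min_le_left _ _).trans
      (Real.sin_le_sin_of_le_of_le_pi_div_two (by linarith [Real.pi_pos]) hx hpx)
  · -- decreasing piece: `sin x = sin (π - x)` with `π - q ≤ π - x ≤ π/2`
    refine (min_le_right _ _).trans ?_
    rw [← Real.sin_pi_sub x, ← Real.sin_pi_sub q]
    exact Real.sin_le_sin_of_le_of_le_pi_div_two (by linarith) (by linarith) (by linarith)

/-- Soundness of `sinBrLo`. [folklore] -/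
theorem sinBrLo_le {p q : ℚ} {x : ℝ} (hp : 0 ≤ p) (hq : ((q : ℚ) : ℝ) ≤ π) (hpx : (p : ℝ) ≤ x) (hxq : x ≤ q) :
    ((sinBrLo p q : ℚ) : ℝ) ≤ Real.sin x := by
  have hq0 : (0 : ℚ) ≤ q := by
    have : (0 : ℝ) ≤ q := (show (0:ℝ) ≤ p by exact_mod_cast hp).trans (hpx.trans hxq)
    exact_mod_cast this
  rw [sinBrLo]; push_cast
  refine le_trans ?_ (min_sin_le_sin (by exact_mod_cast hp) hq hpx hxq)
  exact min_le_min (sinLo_le hp) (sinLo_le hq0)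

/-- Soundness of `sinBrHi`. [folklore] -/
theorem le_sinBrHi {p q : ℚ} {x : ℝ} (hp : 0 ≤ p) (hq : ((q : ℚ) : ℝ) ≤ π) (hpx : (p : ℝ) ≤ x) (hxq : x ≤ q) :
    Real.sin x ≤ ((sinBrHi p q : ℚ) : ℝ) := by
  have hq0 : (0 : ℚ) ≤ q := by
    have : (0 : ℝ) ≤ q := (show (0:ℝ) ≤ p by exact_mod_cast hp).trans (hpx.trans hxq)
    exact_mod_cast this
  unfold sinBrHi
  split_ifs with h1 h2
  · -- `x ≤ q ≤ π/2`: increasing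
    have hq' : ((q : ℚ) : ℝ) ≤ π / 2 := (show ((q:ℚ):ℝ) ≤ pi2Lo by exact_mod_cast h1).trans pi2Lo_lt.le
    refine le_trans (Real.sin_le_sin_of_le_of_le_pi_div_two ?_ hq' hxq) (le_sinHi hq0)
    have : (0:ℝ) ≤ p := by exact_mod_cast hp
    linarith [Real.pi_pos]
  · -- `π/2 ≤ p ≤ x`: decreasing
    have hp' : π / 2 ≤ ((p : ℚ) : ℝ) := lt_pi2Hi.le.trans (by exact_mod_cast h2)
    refine le_trans ?_ (le_sinHi hp)
    rw [← Real.sin_pi_sub x, ← Real.sin_pi_sub (p : ℝ)]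
    exact Real.sin_le_sin_of_le_of_le_pi_div_two (by linarith) (by linarith) (by linarith)
  · push_cast; exact Real.sin_le_one x

/-! ### The cell and its checker -/

/-- A `θ`-cell `[a, b]` with a claimed bracket `[ulo, uhi]` of the Fermi radius on it (all rationals; produced outside the
kernel, VERIFIED by `DOSCell.ok`). [folklore] -/
structure DOSCell where
  /-- left end of the `θ`-cell -/
  a : ℚ
  /-- right end of the `θ`-cell -/
  b : ℚ
  /-- claimed lower bound of `u_μ` on the cell -/
  ulo : ℚ
  /-- claimed upper bound of `u_μ` on the cell -/
  uhi : ℚ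

namespace DOSCell

variable (c : DOSCell)

/-- Upper enclosure of `cos θ` on the cell (`cos` is antitone on `[0, π]`). [folklore] -/
def caHi : ℚ := cosHi c.a
/-- Lower enclosure of `cos θ` on the cell. [folklore] -/
def cbLo : ℚ := cosLo c.b
/-- Lower enclosure of `sin θ` on the cell (`sin` is monotone on `[0, π/2]`). [folklore] -/
def saLo : ℚ := sinLo c.a
/-- Upper enclosure of `sin θ` on the cell. [folklore] -/
def sbHi : ℚ := sinHi c.b
/-- Range of `u cos θ` on the cell: lower end. [folklore] -/
def p1 : ℚ := c.ulo * c.cbLo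
/-- Range of `u cos θ`: upper end. [folklore] -/
def q1 : ℚ := c.uhi * c.caHi
/-- Range of `u sin θ`: lower end. [folklore] -/
def p2 : ℚ := c.ulo * c.saLo
/-- Range of `u sin θ`: upper end. [folklore] -/
def q2 : ℚ := c.uhi * c.sbHi
/-- Lower bracket of `∂_tF(θ, u_μ(θ)) = 2(cos θ sin(u cos θ) + sin θ sin(u sin θ))` on the cell. [folklore] -/
def DtLo : ℚ := 2 * (c.cbLo * sinBrLo c.p1 c.q1 + c.saLo * sinBrLo c.p2 c.q2)
/-- Upper bracket of `∂_tF(θ, u_μ(θ))` on the cell. [folklore] -/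
def DtHi : ℚ := 2 * (c.caHi * sinBrHi c.p1 c.q1 + c.sbHi * sinBrHi c.p2 c.q2)
/-- Lower bracket of the density of states `w_μ = u/∂_tF` on the cell. [folklore] -/
def wLo : ℚ := c.ulo / c.DtHi
/-- Upper bracket of `w_μ` on the cell. [folklore] -/
def wHi : ℚ := c.uhi / c.DtLo

/-- **The rational certificate of a cell** at the level `μq`: geometry of the cell (`0 ≤ a ≤ b ≤ 3/2`), non-negative
trigonometric enclosures, the radius bracket inside `(0, π)` with all nested arguments inside `[0, π]`, the two monotonicity
inequalities certifying `ulo ≤ u_μ(θ) ≤ uhi` (`F(θ, ulo) ≤ μ ≤ F(θ, uhi)` for every `θ` in the cell), and positivity of the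
lower brackets. [folklore] -/
def ok (μq : ℚ) : Bool :=
  decide (0 ≤ c.a) && decide (c.a ≤ c.b) && decide (c.b ≤ 3 / 2) &&
  decide (0 ≤ c.cbLo) && decide (0 ≤ c.saLo) &&
  decide (0 < c.ulo) && decide (c.ulo ≤ c.uhi) && decide (c.uhi ≤ piLo) &&
  decide (c.q1 ≤ piLo) && decide (c.q2 ≤ piLo) &&
  decide (-2 * (cosLo (c.ulo * c.caHi) + cosLo (c.ulo * c.sbHi)) ≤ μq) &&
  decide (μq ≤ -2 * (cosHi (c.uhi * c.cbLo) + cosHi (c.uhi * c.saLo))) &&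
  decide (0 ≤ sinBrLo c.p1 c.q1) && decide (0 ≤ sinBrLo c.p2 c.q2) && decide (0 < c.DtLo)

end DOSCell

/-! ### Soundness of one cell -/

section Sound

variable {μq : ℚ} (hμ₁ : -4 < ((μq : ℚ) : ℝ)) (hμ₂ : ((μq : ℚ) : ℝ) < 0) {c : DOSCell} (hc : c.ok μq = true)
include hμ₁ hμ₂ hc

omit hμ₁ hμ₂ in
/-- Unpacking the Boolean certificate. [folklore] -/
theorem DOSCell.ok_spec :
    (0 ≤ c.a ∧ c.a ≤ c.b ∧ c.b ≤ 3 / 2) ∧ (0 ≤ c.cbLo ∧ 0 ≤ c.saLo) ∧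
    (0 < c.ulo ∧ c.ulo ≤ c.uhi ∧ c.uhi ≤ piLo) ∧ (c.q1 ≤ piLo ∧ c.q2 ≤ piLo) ∧
    (-2 * (cosLo (c.ulo * c.caHi) + cosLo (c.ulo * c.sbHi)) ≤ μq ∧
      μq ≤ -2 * (cosHi (c.uhi * c.cbLo) + cosHi (c.uhi * c.saLo))) ∧
    (0 ≤ sinBrLo c.p1 c.q1 ∧ 0 ≤ sinBrLo c.p2 c.q2 ∧ 0 < c.DtLo) := by
  simp only [DOSCell.ok, Bool.and_eq_true, decide_eq_true_eq] at hc
  tauto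

variable {θ : ℝ} (hθa : ((c.a : ℚ) : ℝ) ≤ θ) (hθb : θ ≤ ((c.b : ℚ) : ℝ))
include hθa hθb

omit hμ₁ hμ₂ in
/-- `cos θ ∈ [cbLo, caHi]` and `sin θ ∈ [saLo, sbHi]` on the cell, with `0 ≤ cbLo`, `0 ≤ saLo`. [folklore] -/
theorem DOSCell.trig_mem :
    ((c.cbLo : ℚ) : ℝ) ≤ Real.cos θ ∧ Real.cos θ ≤ ((c.caHi : ℚ) : ℝ) ∧
    ((c.saLo : ℚ) : ℝ) ≤ Real.sin θ ∧ Real.sin θ ≤ ((c.sbHi : ℚ) : ℝ) := by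
  obtain ⟨⟨ha0, hab, hb⟩, -, -, -, -, -⟩ := DOSCell.ok_spec hc
  have ha0' : (0 : ℝ) ≤ c.a := by exact_mod_cast ha0
  have hb' : ((c.b : ℚ) : ℝ) ≤ 3 / 2 := by
    have := (Rat.cast_le (K := ℝ)).mpr hb; push_cast at this; exact this
  have hpi := Real.pi_gt_d6
  have hθ0 : 0 ≤ θ := ha0'.trans hθa
  have hθ2 : θ ≤ π / 2 := by linarith
  refine ⟨?_, ?_, ?_, ?_⟩
  · exact (cosLo_le c.b).trans (Real.cos_le_cos_of_nonneg_of_le_pi hθ0 (by linarith) hθb)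
  · exact (Real.cos_le_cos_of_nonneg_of_le_pi ha0' (by linarith) hθa).trans (le_cosHi c.a)
  · exact (sinLo_le ha0).trans (Real.sin_le_sin_of_le_of_le_pi_div_two (by linarith) hθ2 hθa)
  · refine (Real.sin_le_sin_of_le_of_le_pi_div_two (by linarith) (by linarith) hθb).trans (le_sinHi ?_)
    exact ha0.trans hab

/-- **The radius bracket is certified**: `ulo ≤ u_μ(θ) ≤ uhi` on the cell (strict monotonicity of `F(θ, ·)` on
`[0, π/‖dir θ‖]` and the two certified inequalities `F(θ, ulo) ≤ μ ≤ F(θ, uhi)`). [folklore] -/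
theorem DOSCell.radius_mem :
    ((c.ulo : ℚ) : ℝ) ≤ bandFermiRadius μq θ ∧ bandFermiRadius μq θ ≤ ((c.uhi : ℚ) : ℝ) := by
  obtain ⟨⟨ha0, hab, hb⟩, ⟨hcb0, hsa0⟩, ⟨hulo0, hlohi, hhipi⟩, ⟨hq1, hq2⟩, ⟨hFlo, hFhi⟩, -⟩ :=
    DOSCell.ok_spec hc
  obtain ⟨hcθlo, hcθhi, hsθlo, hsθhi⟩ := DOSCell.trig_mem hc hθa hθb
  have hpi := piLo_lt_pi
  set u := bandFermiRadius (μq : ℝ) θ with hu_def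
  have hu := isBandFermiRadius_bandFermiRadius hμ₁ hμ₂ θ
  have hmono := strictMonoOn_rayDispersion_band θ
  have hnd := norm_dir_pos θ
  have hnd1 := norm_dir_le_one θ
  -- the bracket ends lie in the monotonicity interval
  have hπT : π ≤ π / ‖dir θ‖ := by rw [le_div_iff₀ hnd]; nlinarith [Real.pi_pos]
  have hulo0' : (0 : ℝ) < c.ulo := by exact_mod_cast hulo0
  have hlohi' : ((c.ulo : ℚ) : ℝ) ≤ c.uhi := by exact_mod_cast hlohi
  have hhipi' : ((c.uhi : ℚ) : ℝ) < π := lt_of_le_of_lt (by exact_mod_cast hhipi) hpi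
  have hloI : ((c.ulo : ℚ) : ℝ) ∈ Icc 0 (π / ‖dir θ‖) := ⟨hulo0'.le, by linarith⟩
  have hhiI : ((c.uhi : ℚ) : ℝ) ∈ Icc 0 (π / ‖dir θ‖) := ⟨hulo0'.le.trans hlohi', by linarith⟩
  have huI := hu.mem_Icc
  -- cosine comparisons on `[0, π]`
  have hcb0' : (0 : ℝ) ≤ c.cbLo := by exact_mod_cast hcb0
  have hsa0' : (0 : ℝ) ≤ c.saLo := by exact_mod_cast hsa0
  have hcos0 : 0 ≤ Real.cos θ := hcb0'.trans hcθlo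
  have hsin0 : 0 ≤ Real.sin θ := hsa0'.trans hsθlo
  have hq1' : ((c.uhi : ℚ) : ℝ) * c.caHi < π := lt_of_le_of_lt (by exact_mod_cast hq1) hpi
  have hq2' : ((c.uhi : ℚ) : ℝ) * c.sbHi < π := lt_of_le_of_lt (by exact_mod_cast hq2) hpi
  constructor
  · -- `ulo ≤ u`: otherwise `F(θ,u) < F(θ,ulo) ≤ μ = F(θ,u)`
    by_contra h
    have hlt : u < c.ulo := lt_of_not_ge h
    have hF := hmono huI hloI hlt
    dsimp only at hF
    rw [hu.2, rayDispersion_eq] at hF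
    dsimp only at hF
    -- bound `F(θ, ulo)` from above by the certified rational
    have h1 : Real.cos (c.ulo * c.caHi) ≤ Real.cos (c.ulo * Real.cos θ) :=
      Real.cos_le_cos_of_nonneg_of_le_pi (by positivity) (by nlinarith)
        (mul_le_mul_of_nonneg_left hcθhi hulo0'.le)
    have h2 : Real.cos (c.ulo * c.sbHi) ≤ Real.cos (c.ulo * Real.sin θ) :=
      Real.cos_le_cos_of_nonneg_of_le_pi (by positivity) (by nlinarith)
        (mul_le_mul_of_nonneg_left hsθhi hulo0'.le)
    have h3 := cosLo_le (c.ulo * c.caHi)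
    have h4 := cosLo_le (c.ulo * c.sbHi)
    have hFlo' : (-2 : ℝ) * ((cosLo (c.ulo * c.caHi) : ℝ) + (cosLo (c.ulo * c.sbHi) : ℝ)) ≤ μq := by
      exact_mod_cast hFlo
    push_cast at h3 h4 hFlo'
    linarith
  · -- `u ≤ uhi`: otherwise `μ = F(θ,u) > F(θ,uhi) ≥ μ`
    by_contra h
    have hlt : ((c.uhi : ℚ) : ℝ) < u := lt_of_not_ge h
    have hF := hmono hhiI huI hlt
    dsimp only at hF
    rw [hu.2, rayDispersion_eq] at hF
    dsimp only at hF
    have huhi0 : (0 : ℝ) ≤ c.uhi := hulo0'.le.trans hlohi'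
    have h1 : Real.cos (c.uhi * Real.cos θ) ≤ Real.cos (c.uhi * c.cbLo) :=
      Real.cos_le_cos_of_nonneg_of_le_pi (by positivity) (by nlinarith)
        (mul_le_mul_of_nonneg_left hcθlo huhi0)
    have h2 : Real.cos (c.uhi * Real.sin θ) ≤ Real.cos (c.uhi * c.saLo) :=
      Real.cos_le_cos_of_nonneg_of_le_pi (by positivity) (by nlinarith)
        (mul_le_mul_of_nonneg_left hsθlo huhi0)
    have h3 := le_cosHi (c.uhi * c.cbLo)
    have h4 := le_cosHi (c.uhi * c.saLo)
    have hFhi' : ((μq : ℚ) : ℝ) ≤ (-2 : ℝ) * ((cosHi (c.uhi * c.cbLo) : ℝ) + (cosHi (c.uhi * c.saLo) : ℝ)) := by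
      exact_mod_cast hFhi
    push_cast at h3 h4 hFhi'
    linarith

/-- **The radial-derivative bracket**: `DtLo ≤ ∂_tF(θ, u_μ(θ)) ≤ DtHi` on the cell. [folklore] -/
theorem DOSCell.Dt_mem :
    ((c.DtLo : ℚ) : ℝ) ≤ rayDispersionDt θ (bandFermiRadius μq θ) ∧
      rayDispersionDt θ (bandFermiRadius μq θ) ≤ ((c.DtHi : ℚ) : ℝ) := by
  obtain ⟨⟨ha0, hab, hb⟩, ⟨hcb0, hsa0⟩, ⟨hulo0, hlohi, hhipi⟩, ⟨hq1, hq2⟩, -, ⟨hs1, hs2, -⟩⟩ :=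
    DOSCell.ok_spec hc
  obtain ⟨hcθlo, hcθhi, hsθlo, hsθhi⟩ := DOSCell.trig_mem hc hθa hθb
  obtain ⟨hulo, huhi⟩ := DOSCell.radius_mem hμ₁ hμ₂ hc hθa hθb
  set u := bandFermiRadius (μq : ℝ) θ
  have hpi := piLo_lt_pi
  have hulo0' : (0 : ℝ) < c.ulo := by exact_mod_cast hulo0
  have hu0 : 0 ≤ u := hulo0'.le.trans hulo
  have hcb0' : (0 : ℝ) ≤ c.cbLo := by exact_mod_cast hcb0
  have hsa0' : (0 : ℝ) ≤ c.saLo := by exact_mod_cast hsa0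
  have hcos0 : 0 ≤ Real.cos θ := hcb0'.trans hcθlo
  have hsin0 : 0 ≤ Real.sin θ := hsa0'.trans hsθlo
  -- `x₁ = u cos θ ∈ [p1, q1] ⊂ [0, π]`, `x₂ = u sin θ ∈ [p2, q2] ⊂ [0, π]`
  have hp1 : ((c.p1 : ℚ) : ℝ) ≤ u * Real.cos θ := by
    rw [DOSCell.p1]; push_cast; exact mul_le_mul hulo hcθlo hcb0' hu0
  have hq1' : u * Real.cos θ ≤ ((c.q1 : ℚ) : ℝ) := by
    rw [DOSCell.q1]; push_cast; exact mul_le_mul huhi hcθhi hcos0 (hu0.trans huhi)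
  have hp2 : ((c.p2 : ℚ) : ℝ) ≤ u * Real.sin θ := by
    rw [DOSCell.p2]; push_cast; exact mul_le_mul hulo hsθlo hsa0' hu0
  have hq2' : u * Real.sin θ ≤ ((c.q2 : ℚ) : ℝ) := by
    rw [DOSCell.q2]; push_cast; exact mul_le_mul huhi hsθhi hsin0 (hu0.trans huhi)
  have hp10 : 0 ≤ c.p1 := by have := mul_nonneg hulo0.le hcb0; simpa [DOSCell.p1] using this
  have hp20 : 0 ≤ c.p2 := by have := mul_nonneg hulo0.le hsa0; simpa [DOSCell.p2] using this
  have hq1π : ((c.q1 : ℚ) : ℝ) ≤ π := (show ((c.q1:ℚ):ℝ) ≤ piLo by exact_mod_cast hq1).trans hpi.le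
  have hq2π : ((c.q2 : ℚ) : ℝ) ≤ π := (show ((c.q2:ℚ):ℝ) ≤ piLo by exact_mod_cast hq2).trans hpi.le
  have hs1lo := sinBrLo_le hp10 hq1π hp1 hq1'
  have hs1hi := le_sinBrHi hp10 hq1π hp1 hq1'
  have hs2lo := sinBrLo_le hp20 hq2π hp2 hq2'
  have hs2hi := le_sinBrHi hp20 hq2π hp2 hq2'
  have hs10 : (0 : ℝ) ≤ sinBrLo c.p1 c.q1 := by exact_mod_cast hs1
  have hs20 : (0 : ℝ) ≤ sinBrLo c.p2 c.q2 := by exact_mod_cast hs2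
  have hsin1 : 0 ≤ Real.sin (u * Real.cos θ) := hs10.trans hs1lo
  have hsin2 : 0 ≤ Real.sin (u * Real.sin θ) := hs20.trans hs2lo
  rw [rayDispersionDt, DOSCell.DtLo, DOSCell.DtHi]
  push_cast
  constructor
  · nlinarith [mul_le_mul hcθlo hs1lo hs10 hcos0, mul_le_mul hsθlo hs2lo hs20 hsin0]
  · nlinarith [mul_le_mul hcθhi hs1hi hsin1 ((hcb0'.trans hcθlo).trans hcθhi),
      mul_le_mul hsθhi hs2hi hsin2 ((hsa0'.trans hsθlo).trans hsθhi)]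

/-- **Soundness of the cell bracket for the density of states**: `wLo ≤ w_μ(θ) ≤ wHi` on the cell. [folklore] -/
theorem DOSCell.dos_mem :
    ((c.wLo : ℚ) : ℝ) ≤ fermiPolarDOS μq θ ∧ fermiPolarDOS μq θ ≤ ((c.wHi : ℚ) : ℝ) := by
  obtain ⟨-, -, ⟨hulo0, hlohi, -⟩, -, -, ⟨-, -, hDt0⟩⟩ := DOSCell.ok_spec hc
  obtain ⟨hulo, huhi⟩ := DOSCell.radius_mem hμ₁ hμ₂ hc hθa hθb
  obtain ⟨hDlo, hDhi⟩ := DOSCell.Dt_mem hμ₁ hμ₂ hc hθa hθb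
  have hDt0' : (0 : ℝ) < c.DtLo := by exact_mod_cast hDt0
  have hD0 : 0 < rayDispersionDt θ (bandFermiRadius (μq : ℝ) θ) := hDt0'.trans_le hDlo
  have hulo0' : (0 : ℝ) < c.ulo := by exact_mod_cast hulo0
  rw [klpt_fermiPolarDOS_eq hμ₁ hμ₂, DOSCell.wLo, DOSCell.wHi]
  push_cast
  constructor
  · -- `ulo / DtHi ≤ u / Dt`
    exact div_le_div₀ (hulo0'.le.trans hulo) hulo hD0 hDhi
  · -- `u / Dt ≤ uhi / DtLo`
    exact div_le_div₀ (hulo0'.le.trans (hulo.trans huhi)) huhi hDt0' hDlo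

end Sound

end Summit.HubbardSuperconductivity.HubbardSuperconductivity.Theorems.KlCertQuad

end
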